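import Summits.ABC.IUTFork.Joshi.RosettaIndeterminacies
import HarnessLib

/-!
# Joshi, *Arithmetic Teichmüller Spaces III* (arXiv:2401.13508v4) §8.9–§8.11 à la Joshi — what is DERIVABLE over the typed
# signature of `Joshi/RosettaIndeterminacies.lean` (proof companion)

Proof-only companion (abc-iut cell, branch E, rung LADDER-ABC:A2.E; seat abc-iut-E-t18, slot T-18) of the statement file
`Joshi/RosettaIndeterminacies.lean` (never edited or restated here). **No side is taken** on [IUTchIII] Cor. 3.12, on Joshi's
claims, or on Mochizuki's report on them; typed ≠ proved ≠ endorsed. Contents: (§2) the column of iterated log-links is the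
forward Frobenius orbit and sits `n` steps up a vertical line under the dictionary `IteratedLogLinksDict` (Rmk 8.9.2 (1), p.90
l.6–13); (§4) Ind3/Ind2 moves vs. the log-link ([J-I] Thm 5.21.1 (4)), the §8.11 indeterminacy from an Ind2-move, Prop.
8.11.1.1 over the signature from the two inputs its printed proof names (p.92 l.41–46: amphoric degree = [AbsAnab] Prop 1.2.1
(v), FACT-LIST F-0022; Krasner, F-2749) and its second assertion (image of a finite set); (§5) the canonical sentences of
§8.11.2 from the moves. The binding of these moves to OUR (Ind1)/(Ind2) families is the dictionary-topic file
`Joshi/DictionaryIndeterminacies.lean` (E-PLAN R14); nothing of OUR side and nothing about the q- or Θ-pilots occurs here.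
Locators as in the statement file. [claim: Joshi2024ATS3, status: disputed] [claim: Joshi2021ATS1, status: disputed]
[claim: Joshi2023ATS2Local, status: disputed]; inputs [cite: MochizukiAbsAnab2004, Prop 1.2.1 (v) p.10],
[cite: BombieriGubler2006, proof of Prop 4.5.3]. Standard axioms only.
-/

noncomputable section

namespace Summit.ABC.IUTFork.Joshi.ATS3

open Function Set

namespace RosettaIndDatum

variable (𝔍 : RosettaIndDatum)

/-! ## 2. The column of log-links (Def 8.9.1, Rmk 8.9.2 (1)) -/

/-- The log-link IS the Frobenius on parameters (Def. 8.9.1 as typed). [claim: Joshi2024ATS3, status: disputed] -/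
theorem logLink_eq_frob (y : 𝔍.GlobalPt) : 𝔍.logLink y = 𝔍.frob y := rfl

/-- The column starts at `y`. [folklore] -/
theorem logLinkColumn_zero (y : 𝔍.GlobalPt) : 𝔍.logLinkColumn y 0 = y := rfl

/-- Each step of the column is one log-link (Rmk. 8.9.2 (1)). [claim: Joshi2024ATS3, status: disputed] -/
theorem logLinkColumn_succ (y : 𝔍.GlobalPt) (n : ℕ) :
    𝔍.logLinkColumn y (n + 1) = 𝔍.logLink (𝔍.logLinkColumn y n) :=
  Function.iterate_succ_apply' 𝔍.frob n y

/-- Every point lies in its own column. [folklore] -/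
theorem sameLogColumn_refl (y : 𝔍.GlobalPt) : 𝔍.SameLogColumn y y := ⟨0, Or.inl rfl⟩

/-- The relation is symmetric. [folklore] -/
theorem SameLogColumn.symm {𝔍 : RosettaIndDatum} {y y' : 𝔍.GlobalPt} (h : 𝔍.SameLogColumn y y') :
    𝔍.SameLogColumn y' y := by
  obtain ⟨n, h | h⟩ := h
  exacts [⟨n, Or.inr h⟩, ⟨n, Or.inl h⟩]

/-- A point and its log-link lie in one column (the move `y_0 ↦ ϕ(y_0)` of §8.11.1 Ind3). [claim: Joshi2024ATS3, status: disputed] -/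
theorem sameLogColumn_logLink (y : 𝔍.GlobalPt) : 𝔍.SameLogColumn y (𝔍.logLink y) := ⟨1, Or.inl rfl⟩

/-- Under the correspondence the `n`-th vertex of Joshi's column sits `n` steps up Mochizuki's. [folklore] -/
theorem col_logLinkColumn {col : 𝔍.GlobalPt → ℤ} (h : 𝔍.IteratedLogLinksDict col) (y : 𝔍.GlobalPt) (n : ℕ) :
    col (𝔍.logLinkColumn y n) = col y + n := by
  induction n with
  | zero => simp [logLinkColumn_zero]
  | succ n ih => rw [logLinkColumn_succ, h, ih]; push_cast; ring

/-! ## 3. Θgau-links (pointer) -/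

/-- A Θgau-link is determined by its point of the Ansatz (Rmk. 4.2.3.2 (1)). [folklore] -/
theorem ThetaGauLink.ext {𝔍 : RosettaIndDatum} {z z' : 𝔍.ThetaGauLink} (h : z.1 = z'.1) : z = z' := Subtype.ext h

/-! ## 4. The three indeterminacies as moves; Prop 8.11.1.1 over the signature -/

/-- If two points of the curve at `v` provide DISTINCT holomorphoids, then `hol ↦ Π^{temp}` is not injective at `v`
(all points give the same group, `pi1_holOf`). DERIVED over the signature. [folklore] -/
theorem not_injective_pi1_of_holOf_ne {v : 𝔍.V} {y y' : 𝔍.Yloc v} (h : 𝔍.holOf v y ≠ 𝔍.holOf v y') :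
    ¬ Injective (𝔍.pi1 v) := fun hinj => h (hinj (𝔍.pi1_holOf v y y'))

/-- The standard point and its Frobenius translate are Ind3-related (p.91 l.23–25 «This choice is not canonical and one
can also use ϕ(y_0) as a standard point»). [claim: Joshi2024ATS3, status: disputed] -/
theorem jInd3_logLink (y : 𝔍.GlobalPt) : 𝔍.JInd3 y (𝔍.logLink y) := 𝔍.sameLogColumn_logLink y

/-- Under [J-I] Thm 5.21.1 (4), an Ind2-move commutes with the log-link at `v`: Ind2-related points have Ind2-related
Frobenius translates (Ind2 acts on columns). DERIVED. [claim: Joshi2021ATS1, status: disputed] -/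
theorem jInd2_frobLoc (h : 𝔍.AutCommutesFrob) {v : 𝔍.V} {y y' : 𝔍.Yloc v} (hy : 𝔍.JInd2 v y y') :
    𝔍.JInd2 v (𝔍.frobLoc v y) (𝔍.frobLoc v y') := by
  obtain ⟨σ, rfl⟩ := hy
  exact ⟨σ, h v σ y⟩

/-- An Ind2-move that changes the holomorphoid witnesses the §8.11 indeterminacy at `v` (§8.11.2 «Mochizuki's Ind2: the
local holomorphoid of X/L_v is not uniquely determined by Π^{temp}_{X/L_v}»). DERIVED. [claim: Joshi2024ATS3, status: disputed] -/
theorem not_injective_pi1_of_jInd2 {v : 𝔍.V} {y y' : 𝔍.Yloc v} (_hy : 𝔍.JInd2 v y y')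
    (h : 𝔍.holOf v y ≠ 𝔍.holOf v y') : ¬ Injective (𝔍.pi1 v) :=
  𝔍.not_injective_pi1_of_holOf_ne h

/-- `L_v` is one of its own anabelomorphs. [folklore] -/
theorem base_mem_jInd1 (v : 𝔍.V) : 𝔍.base v ∈ 𝔍.JInd1 v := (𝔍.anab_equiv v).refl _

/-- The range of the Ind1-move is closed under anabelomorphy. [folklore] -/
theorem mem_jInd1_of_anab {v : 𝔍.V} {E E' : 𝔍.Fld v} (hE : E ∈ 𝔍.JInd1 v) (h : 𝔍.anab v E E') : E' ∈ 𝔍.JInd1 v :=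
  (𝔍.anab_equiv v).trans hE h

/-- Prop. 8.11.1.1 along its printed proof (p.92 l.41–46): if the degree over `Q_{p_v}` is amphoric («[E : Q_p] is an
amphoric quantity», [Joshi 2020a] = [AbsAnab] Prop 1.2.1 (v), FACT-LIST F-0022) and there are only finitely many fields of
each degree inside `Q̄_{p_v}` (Krasner, F-2749), then the Ind1-range is finite at every place. DERIVED (inputs as hypotheses
on an abstract degree function; the Mathlib instance is the companion file). [cite: MochizukiAbsAnab2004, Prop 1.2.1 (v) p.10]
[cite: BombieriGubler2006, proof of Prop 4.5.3] -/
theorem jInd1Finite_of_amphoric_degree (deg : ∀ v, 𝔍.Fld v → ℕ)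
    (hdeg : ∀ v (E E' : 𝔍.Fld v), 𝔍.anab v E E' → deg v E = deg v E')
    (hfin : ∀ v (d : ℕ), {E' : 𝔍.Fld v | deg v E' = d}.Finite) : 𝔍.JInd1Finite := fun v =>
  (hfin v (deg v (𝔍.base v))).subset fun _ hE' => (hdeg v _ _ hE').symm

/-- Second assertion of Prop. 8.11.1.1 (p.92 l.33–40): finitely many isomorphism classes of Fargues–Fontaine curves
`X_{C♭_p,E′}` with `π^{et}_1 = G_E` — the image of the finite Ind1-range under `E′ ↦ X_{C♭_p,E′}`. DERIVED. [claim: Joshi2024ATS3, status: disputed] -/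
theorem curves_of_jInd1_finite (h : 𝔍.JInd1Finite) (v : 𝔍.V) : (𝔍.curveOf v '' 𝔍.JInd1 v).Finite :=
  (h v).image _

/-! ## 5. The canonical sentences of §8.11.2 -/

/-- The orbit conjunct of `CanonicalInd3` is definitional; the content is `KummerShift`. [folklore] -/
theorem canonicalInd3_iff : 𝔍.CanonicalInd3 ↔ 𝔍.KummerShift :=
  ⟨fun h => h.1, fun h => ⟨h, fun _ _ => Iff.rfl⟩⟩

/-- If at every place some Ind2-move changes the holomorphoid, the canonical Ind2 sentence follows. DERIVED.
[claim: Joshi2024ATS3, status: disputed] -/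
theorem canonicalInd2_of_jInd2_moves
    (h : ∀ v : 𝔍.V, ∃ y y' : 𝔍.Yloc v, 𝔍.JInd2 v y y' ∧ 𝔍.holOf v y ≠ 𝔍.holOf v y') : 𝔍.CanonicalInd2 := fun v => by
  obtain ⟨y, y', hy, hne⟩ := h v
  exact 𝔍.not_injective_pi1_of_jInd2 hy hne

/-- The printed ∀-form gives the ∃-form as soon as there is a place. [folklore] -/
theorem canonicalInd1Weak_of_canonicalInd1 [Nonempty 𝔍.V] (h : 𝔍.CanonicalInd1) : 𝔍.CanonicalInd1Weak :=
  let ⟨v⟩ := ‹Nonempty 𝔍.V›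
  ⟨v, h v⟩

/-- Where the Ind1 sentence holds the Ind1-range has at least two elements (`L_v` and a strict anabelomorph), so the
averages of §8.11.1 run over a finite set (Prop 8.11.1.1) with more than one member. DERIVED. [claim: Joshi2024ATS3, status: disputed] -/
theorem nontrivial_jInd1_of_canonicalInd1 (hrefl : ∀ v (E : 𝔍.Fld v), 𝔍.fiso v E E) (h : 𝔍.CanonicalInd1)
    (v : 𝔍.V) : ∃ E ∈ 𝔍.JInd1 v, ∃ E' ∈ 𝔍.JInd1 v, E ≠ E' := by
  obtain ⟨E', hE', hne⟩ := h v
  refine ⟨𝔍.base v, 𝔍.base_mem_jInd1 v, E', hE', fun heq => hne ?_⟩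
  rw [← heq]; exact hrefl v _

/-! ## 6. After the typer-side second read (E-t62 INFO I2/I3): orbit form of Thm 5.21.1 (4); transitivity of the column relation (appended) -/

/-- Commutation with Frobenius gives the printed orbit form of [J-I] Thm 5.21.1 (4) (with `m = n`). DERIVED. [claim: Joshi2021ATS1, status: disputed] -/
theorem autPreservesFrobOrbits_of_autCommutesFrob (h : 𝔍.AutCommutesFrob) : 𝔍.AutPreservesFrobOrbits := by
  intro v σ y n
  refine ⟨n, ?_⟩
  induction n generalizing y with
  | zero => rfl
  | succ n ih =>
      rw [Function.iterate_succ_apply, Function.iterate_succ_apply, ih (𝔍.frobLoc v y), h v σ y]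

/-- A bijective Frobenius is injective. [folklore] -/
theorem frobInjective_of_frobBijective (h : 𝔍.FrobBijective) : 𝔍.FrobInjective := fun v => (h v).1

/-- Injectivity of every local Frobenius gives injectivity of the global Frobenius (componentwise). [folklore] -/
theorem frob_injective (h : 𝔍.FrobInjective) : Function.Injective 𝔍.frob := fun _ _ hy =>
  funext fun v => h v (congrFun hy v)

/-- Two points with a common forward iterate lie in one column (under injectivity of Frobenius). [folklore] -/
theorem sameLogColumn_of_iterate_eq (h : 𝔍.FrobInjective) {y y'' : 𝔍.GlobalPt} {n m : ℕ}
    (he : 𝔍.frob^[n] y = 𝔍.frob^[m] y'') : 𝔍.SameLogColumn y y'' := by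
  rcases le_total n m with hnm | hmn
  · obtain ⟨k, rfl⟩ := Nat.exists_eq_add_of_le hnm
    rw [Function.iterate_add_apply] at he
    exact ⟨k, Or.inr ((𝔍.frob_injective h).iterate n he).symm⟩
  · obtain ⟨k, rfl⟩ := Nat.exists_eq_add_of_le hmn
    rw [Function.iterate_add_apply] at he
    exact ⟨k, Or.inl ((𝔍.frob_injective h).iterate m he)⟩

/-- **`SameLogColumn` is transitive when the Frobenius is injective** (in print ϕ is an automorphism, `FrobBijective`; E-t62 INFO I3): «lying in one
column of log-links» is then an equivalence relation (with `sameLogColumn_refl`, `SameLogColumn.symm`). DERIVED. [claim: Joshi2024ATS3, status: disputed] -/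
theorem SameLogColumn.trans_of_frobInjective (h : 𝔍.FrobInjective) {y y' y'' : 𝔍.GlobalPt} (h1 : 𝔍.SameLogColumn y y')
    (h2 : 𝔍.SameLogColumn y' y'') : 𝔍.SameLogColumn y y'' := by
  obtain ⟨n, hn | hn⟩ := h1 <;> obtain ⟨m, hm | hm⟩ := h2 <;> simp only [logLinkColumn] at hn hm
  · exact ⟨m + n, Or.inl (by simp only [logLinkColumn]; rw [Function.iterate_add_apply, hn, hm])⟩
  · exact 𝔍.sameLogColumn_of_iterate_eq h (n := n) (m := m) (by rw [hn, hm])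
  · exact 𝔍.sameLogColumn_of_iterate_eq h (n := m) (m := n) (by rw [← hn, ← hm, ← Function.iterate_add_apply,
      ← Function.iterate_add_apply, Nat.add_comm])
  · exact ⟨n + m, Or.inr (by simp only [logLinkColumn]; rw [Function.iterate_add_apply, hm, hn])⟩

/-- Hence, under `FrobBijective`, Joshi's Ind3 relation `JInd3` (= `SameLogColumn`) is an equivalence relation on global points. DERIVED.
[claim: Joshi2024ATS3, status: disputed] -/
theorem jInd3_equivalence (h : 𝔍.FrobBijective) : Equivalence 𝔍.JInd3 :=
  ⟨𝔍.sameLogColumn_refl, fun hxy => hxy.symm,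
    fun hxy hyz => SameLogColumn.trans_of_frobInjective 𝔍 (𝔍.frobInjective_of_frobBijective h) hxy hyz⟩

end RosettaIndDatum

end Summit.ABC.IUTFork.Joshi.ATS3

end
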